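import Literature.MathematicalPhysics.QuantumFieldTheory.Balaban1983to89.B13Replacement223
import Literature.MathematicalPhysics.QuantumFieldTheory.Balaban1983to89.B13CauchyDecay

/-!
# `Balaban1983to89.B13Bound226Assembly` — T. Bałaban, *Renormalization group approach to lattice gauge field theories.
II. Cluster expansions*, Commun. Math. Phys. **116** (1988) 1–22 [Balaban1988RG2Cluster], pp. 15–17: the bound (2.26)
of the generic term (2.14), ASSEMBLED END TO END for the typed objects — *"This ends the estimate of the expression
(2.14). Gathering together all the bounds we get (2.26)"* — from the Cauchy prefactors (`B13CauchyDecay`), the first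
estimate (2.15) and the perturbative replacement (`B13FirstEstimate215`, `B13Replacement223`) and the Gaussian
computation (2.23)–(2.25) (`B13Integral223`), every printed input ((2.16)/(2.17)/(2.21)-shaped replacement errors,
(2.20), (2.22), analyticity in the parameters) entered as a hypothesis UNIFORM on the parameter polydiscs

statement-level skeleton of published theorems with citation tags; proofs where landed; nothing here is a claim about
the Yang–Mills mass gap

PDF held: `paper:balaban1988-cmp116-rg-ii-cluster` (journal page = PDF page + 0); pp. 15–17 read as images from
`run/shared/lean/pub/pub-balaban/b2b-balaban-ref1/pages/1988-cmp116-rg-II-cluster/1988-cmp116-rg-II-cluster-p015-x2.png`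
… `…-p017-x2.png` (cell transcript `pub-balaban/b2b-balaban-b13/transcript-B13.md` ll. 144–165).

CITATION HEADER (verbatim, p. 17 [PDF 17]): *"These calculations and estimates yield `∫dμ₀(X)|_Z exp ½O(α₅)‖ZX‖² =
Π_{b∈Z}(1 − O(α₅))^{−½d(𝔤)} ≦ exp(O(α₅)|Z|),` (2.25) where d(𝔤) is the dimension of the Lie algebra 𝔤 of the group G.
This ends the estimate of the expression (2.14). Gathering together all the bounds we get*
`|(2.14)| ≦ exp(−(κ₁ − 1)(LM)⁻⁴|Z∖Z′₀|)[Π_{Y∈𝐃} 2E₀ε₁C₁α₄⁻¹M^q exp C₂κ₁ exp(−(1 − 3δ)κd_k(Y))]`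
`          · exp(−½γ₂(ε₁²/g_k²)|P|) · exp O(1)α₅|Z|.`  (2.26)"  and p. 15 (2.15): *"The first estimate is |(7.14)| ≦
exp(−(κ₁ − 1)(LM)⁻⁴|Z∖Z′₀|) Π_{Y∈𝐃} 2/|τ(Y)| · ∫dμ₀(X)|_Z exp(−½Re⟨…⟩) · |det(C^{(k)}(Z₀,σ(Z))⁻¹)/det(Re C^{(k)}(Z₀,
σ(Z))⁻¹)|^{1/2} ∫dμ_{(Re C^{(k)}(Z₀σ(Z))⁻¹)⁻¹}(B) exp(−⟨B, Re Γ_k(Z₀,σ(Z))X⟩) χ_{k,Y₀}χᶜ_{k,P} exp[Σ_{Y∈𝐃}|τ(Y)||𝐕_k(Y,B)|].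
In the expression on the right-hand side we replace the operators by the corresponding operators with σ(Z) = 0, 𝐔 =
U, 𝐉 = 0, and we estimate the error."*

WHAT IS REPRODUCED (unit `lit-balaban-r10` gen 9, B13 fold owner; SKELETON row `B13.Eq2.26` of
`HOME/lit-balaban-r10/ROWS-B13.md`, whose head reads «typed-existing (shape …; the step (2.15)–(2.25) ⇒ (2.26) itself is
by assertion in print, transcript loci L16a/L17a)»; rows B13.Eq2.14 / B13.Eq2.15 / B13.Def2.23 upstream).  For the
typed generic term (2.14) — `B13Term214.term214 r lZ lD (B13Term214.core214 A Γ F) σ₀ τ₀` with `A(σ) = C^{(k)}(Z₀,σ)⁻¹`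
(complex precision), `Γ(σ) = Γ_k(Z₀,σ)`, the printed last line `F(τ) = (−1)^{|P|}χ_{k,Y₀}χᶜ_{k,P}exp[Σ_{Y∈𝐃}τ(Y)𝐕_k(Y,·)]`
(`B13Term214.F214`), σ-parameters `lZ` (the `LM`-cubes of `Z∖Z′₀`) and τ-parameters `lD` (the domains of `𝐃`) —:
* §1 `norm_core214_F214_le_K` — THE SUP BOUND `K` of the last three lines of (2.14) on the two closed parameter
  polydiscs `{|σ(Δ)| ≤ e^{κ₁}}`, `{|τ(Y)| ≤ R_τ(Y)}`: if, UNIFORMLY for the `σ` of the σ-polydisc, `A(σ)` is symmetric with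
  `Re A(σ) ≻ 0` and the replacement errors against the `σ = 0` objects `C = C^{(k)}(Z₀,0)`, `Γ₀ = Γ_k(Z₀,0)` have the
  printed shapes with uniform constants (`R₁`: (2.21) with `ρ`; the two determinant factors (2.17) with `η`; `R₂`, `R₃`:
  (2.21) with `ρ`), `X ↦ Γ(σ)X` is continuous, the characteristic functions obey (2.22) (`γ₂`) and the interaction obeys
  (2.20) AT THE τ-RADII (`Σ_{Y∈𝐃} R_τ(Y)|𝐕_k(Y,B)| ≤ ½a‖Z₀B‖² + w` — (2.20) is printed with `|τ(Y)|` = the radius), and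
  `C` obeys the (2.24)–(2.25) smallness (`λ_k(C) ≤ c`, `⟨Γ₀X,CΓ₀X⟩ ≤ g‖X‖²`, `α₅c ≤ ½`, `α₅(1+2cg) ≤ ½`, `α₅ = 2ρ + γ₂ +
  a`), THEN `‖∫dμ₀(X)|_Z (lines 2–4 of (2.14))(σ, τ)‖ ≤ K := e^{2η|Λ|}·exp(−½γ₂(ε₁²/g_k²)|P| + w)·e^{α₅c|Λ|}·
  e^{α₅(1+2cg)|N|}` on the polydiscs (`B13Replacement223.norm_core214_F214_le_223_of_continuous` +
  `B13Integral223.integral223_le`; `|Λ|`, `|N|` = the real dimensions of `Z₀B`, `ZX`).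
* §2 **`norm_term214_le_226_assembled`** — (2.26): with, in addition, `∫dμ₀(X)|_Z(lines 2–4)` separately holomorphic
  in the `σ(Δ)` on an open `Uσ ⊇ {|σ| ≤ e^{κ₁}}` (`κ₁ ≥ 1`) and in the `τ(Y)` on an open `Uτ ⊇ {|τ| ≤ R_τ(Y)}`, `R_τ(Y) ≥
  2` (p. 15 *"We consider it as an analytic function … of the complex parameters σ(Z), τ"*), base points in the unit
  polydiscs: `|(2.14)| ≤ exp(−(κ₁ − 1)|lZ|) · [Π_{Y∈𝐃} 2/R_τ(Y)] · K` — (2.26) with its four factors: the Cauchy decay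
  `exp(−(κ₁−1)(LM)⁻⁴|Z∖Z′₀|)`, the bracket `Π 2/|τ(Y)|` (= `Π 2E₀ε₁C₁α₄⁻¹M^q e^{C₂κ₁}e^{−(1−3δ)κd_k(Y)}` at the radii
  (2.18): `norm_term214_le_226_assembled_218`, §3), `exp(−½γ₂(ε₁²/g_k²)|P|)`, and `exp O(1)α₅|Z|` (here the explicit
  `e^{2η|Λ|}e^{w}e^{α₅c|Λ|}e^{α₅(1+2cg)|N|}`, `η ≤ α₅`, `w = O(1)α₄M⁻⁴|Y₀|`, `|Λ| ≤ |N|`).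
HONEST SCOPE.  An ASSEMBLY: every analytic input of pp. 15–17 is a hypothesis in its printed shape, uniform on the
parameter polydiscs — the LEAF (2.16) (that the analytically continued operators differ from their `σ = 0`, `(U, 0)`
values by (2.16)-type kernels, `θ = O(1)e^{−⅓δ₀M} + O(α₀+α₁)`; cell locus L16a; `B13Replacement223` §6 turns
(2.16)-type row-sum bounds into the `R₁/R₂/R₃`/(2.17) shapes used here), the [13]/[15] operator norms behind `c`, `g`
(L17a), (2.20) (row B13.Eq2.20, `B13Resum220.ineq220`) and (2.22) (row B13.Eq2.22, `B13.indicator_le_exp_222`) for the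
lattice objects, and the analyticity (`SepHolOn`).  Nothing of these is discharged here; no `sorry`, no definition, no
new named fact (D-0026).

v1.1 (same unit and generation; APPEND-ONLY, v1 declarations byte-identical): §4 `K_le_window_shape`,
`norm_core214_F214_le_window_shape` — the sup bound in the shape `exp(−½a|P|)·exp(a₅·#cells Z)` consumed by the window-model
joiner `B13Lemma3WindowCauchy.h226_of_cauchy` (hypothesis `hK`), when `|Λ|`, `|N|`, `w` are proportional to `#cells Z`.
-/

noncomputable section

namespace Literature.MathematicalPhysics.QuantumFieldTheory.Balaban1983to89.B13Bound226Assembly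

open Complex MeasureTheory Metric Finset Matrix
open B13GaugeDevices (gaussWeight gaussMean)
open B13Term214 (SepHolOn term214 core214 integrand214 cgaussMean F214)
open B13Integral223 (integral223 integral223_le)
open B13Replacement223 (norm_core214_F214_le_223_of_continuous)
open B13CauchyDecay (norm_term214_le_215 norm_term214_le_226)
open B13Bound143 (invTau)

variable {Λ : Type} [Fintype Λ] [DecidableEq Λ] {C₀ : Type} [Fintype C₀] [DecidableEq C₀]
variable {ι κ : Type*}

/-! ## §1. The sup bound `K` of the last three lines of (2.14) on the parameter polydiscs -/

/-- **The constant `K` of the Cauchy estimate** (pp. 15–17): on the closed polydiscs `{|σ(Δ)| ≤ R_σ}`, `{|τ(Y)| ≤ R_τ(Y)}`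
the `X`-integral of lines 2–4 of (2.14) with the printed last line — `B13Term214.core214 A Γ (F214 …) σ τ` — has modulus
`≤ e^{2η|Λ|} · exp(−½γ₂(ε₁²/g_k²)|P| + w) · e^{α₅c|Λ|} · e^{α₅(1+2cg)|N|}`, `α₅ = 2ρ + γ₂ + a`, PROVIDED, uniformly for
the `σ` of the σ-polydisc: `A(σ)` complex symmetric with `Re A(σ) ≻ 0`; the replacement errors against `C = C^{(k)}(Z₀,0)`,
`Γ₀ = Γ_k(Z₀,0)` in their printed shapes — `R₁` ((2.21): `−½Re⟨Γ(σ)X, A(σ)⁻¹Γ(σ)X⟩ ≤ −½⟨Γ₀X,CΓ₀X⟩ + ½ρ‖X‖²`), the two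
determinant factors ((2.17): `≤ e^{η|Λ|}`), `R₂ = C⁻¹ − Re A(σ)` and `R₃ = Re Γ(σ) − Γ₀` ((2.21) with `ρ`); continuity of
`X ↦ Γ(σ)X`; (2.22) for the characteristic functions (`χ_{k,Y₀}χᶜ_{k,P} ≤ exp(−½γ₂(ε₁²/g_k²)|P| + ½γ₂‖PB‖²)`, `‖PB‖² ≤
‖Z₀B‖²`); (2.20) at the τ-radii (`Σ_{Y∈𝐃} R_τ(Y)|𝐕_k(Y,B)| ≤ ½a‖Z₀B‖² + w`); and the (2.24)–(2.25) smallness for `C`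
(`λ_k(C) ≤ c`, `⟨Γ₀X,CΓ₀X⟩ ≤ g‖X‖²`, `α₅c ≤ ½`, `α₅(1+2cg) ≤ ½`).
[cite: Balaban1988RG2Cluster, (2.15) p.15, (2.16)–(2.22) p.16, (2.23)–(2.26) p.17] -/
theorem norm_core214_F214_le_K (A : (ι → ℂ) → Matrix Λ Λ ℂ) (Γ : (ι → ℂ) → (Λ ⊕ C₀ → ℝ) → (Λ → ℂ))
    {C : Matrix Λ Λ ℝ} (hC : C.PosDef) (Γ₀ : Matrix Λ (Λ ⊕ C₀) ℝ) (Rσ : ι → ℝ) (Rτ : κ → ℝ)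
    (hAs : ∀ σ : ι → ℂ, (∀ j, ‖σ j‖ ≤ Rσ j) → (A σ).IsSymm)
    (hA : ∀ σ : ι → ℂ, (∀ j, ‖σ j‖ ≤ Rσ j) → ((A σ).map Complex.re).PosDef)
    (hΓc : ∀ σ : ι → ℂ, (∀ j, ‖σ j‖ ≤ Rσ j) → Continuous (Γ σ))
    (cardP : ℕ) (χY₀ χcP : (Λ → ℝ) → ℝ) (hχ0 : ∀ B, 0 ≤ χY₀ B) (hχc0 : ∀ B, 0 ≤ χcP B) (Dfam : Finset κ)
    (V : κ → (Λ → ℝ) → ℂ) {γ₂ r a w : ℝ} (qP : (Λ → ℝ) → ℝ)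
    (h222 : ∀ B, χY₀ B * χcP B ≤ Real.exp (-(γ₂ / 2 * r ^ 2 * cardP) + γ₂ / 2 * qP B)) (hγ₂ : 0 ≤ γ₂)
    (hqP : ∀ B, qP B ≤ B ⬝ᵥ B) (h220R : ∀ B, ∑ Y ∈ Dfam, Rτ Y * ‖V Y B‖ ≤ a / 2 * (B ⬝ᵥ B) + w)
    {ρ η c g : ℝ} (hρ0 : 0 ≤ ρ) (ha0 : 0 ≤ a)
    (hR1 : ∀ σ : ι → ℂ, (∀ j, ‖σ j‖ ≤ Rσ j) → ∀ X : Λ ⊕ C₀ → ℝ, -(1 / 2) * ((Γ σ X) ⬝ᵥ ((A σ)⁻¹ *ᵥ Γ σ X)).re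
      ≤ -(1 / 2 * ((Γ₀ *ᵥ X) ⬝ᵥ (C *ᵥ (Γ₀ *ᵥ X)))) + ρ / 2 * (X ⬝ᵥ X))
    (h17a : ∀ σ : ι → ℂ, (∀ j, ‖σ j‖ ≤ Rσ j) →
      Real.sqrt (‖(A σ).det‖ / ((A σ).map Complex.re).det) ≤ Real.exp (η * Fintype.card Λ))
    (h17b : ∀ σ : ι → ℂ, (∀ j, ‖σ j‖ ≤ Rσ j) →
      Real.sqrt (((A σ).map Complex.re).det / C⁻¹.det) ≤ Real.exp (η * Fintype.card Λ))
    (hR2 : ∀ σ : ι → ℂ, (∀ j, ‖σ j‖ ≤ Rσ j) →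
      ∀ B : Λ → ℝ, B ⬝ᵥ ((C⁻¹ - (A σ).map Complex.re) *ᵥ B) ≤ ρ * (B ⬝ᵥ B))
    (hR3 : ∀ σ : ι → ℂ, (∀ j, ‖σ j‖ ≤ Rσ j) → ∀ (X : Λ ⊕ C₀ → ℝ) (B : Λ → ℝ),
      -(B ⬝ᵥ fun i => (Γ σ X i).re) ≤ -(B ⬝ᵥ (Γ₀ *ᵥ X)) + ρ / 2 * (X ⬝ᵥ X + B ⬝ᵥ B))
    (hc0 : 0 ≤ c) (hc : ∀ k, hC.1.eigenvalues k ≤ c) (hαc : (2 * ρ + (γ₂ + a)) * c ≤ 1 / 2) (hg : 0 ≤ g)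
    (hΓ : ∀ X : Λ ⊕ C₀ → ℝ, (Γ₀ *ᵥ X) ⬝ᵥ (C *ᵥ (Γ₀ *ᵥ X)) ≤ g * (X ⬝ᵥ X))
    (hsmall : (2 * ρ + (γ₂ + a)) * (1 + 2 * c * g) ≤ 1 / 2) :
    ∀ (σ : ι → ℂ) (τ : κ → ℂ), (∀ j, ‖σ j‖ ≤ Rσ j) → (∀ Y, ‖τ Y‖ ≤ Rτ Y) →
      ‖core214 A Γ (F214 cardP χY₀ χcP Dfam V) σ τ‖
        ≤ Real.exp (2 * η * Fintype.card Λ) * Real.exp (-(γ₂ / 2 * r ^ 2 * cardP) + w)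
          * (Real.exp ((2 * ρ + (γ₂ + a)) * c * Fintype.card Λ)
            * Real.exp ((2 * ρ + (γ₂ + a)) * (1 + 2 * c * g) * Fintype.card (Λ ⊕ C₀))) := by
  intro σ τ hσ hτ
  have h220 : ∀ B, ∑ Y ∈ Dfam, ‖τ Y‖ * ‖V Y B‖ ≤ a / 2 * (B ⬝ᵥ B) + w := fun B =>
    (Finset.sum_le_sum fun Y _ => mul_le_mul_of_nonneg_right (hτ Y) (norm_nonneg _)).trans (h220R B)
  have h1 := norm_core214_F214_le_223_of_continuous (hAs σ hσ) (hA σ hσ) hC (hΓc σ hσ) Γ₀ cardP χY₀ χcP hχ0 hχc0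
    Dfam V τ qP h222 hγ₂ hqP h220 hρ0 ha0 (hR1 σ hσ) (h17a σ hσ) (h17b σ hσ) (hR2 σ hσ) (hR3 σ hσ) hc0 hc hαc hΓ
    (by linarith)
  have h2 := integral223_le hC Γ₀ (α := 2 * ρ + (γ₂ + a)) (by linarith) hc0 hc hαc hg hΓ hsmall
  exact h1.trans (mul_le_mul_of_nonneg_left h2 (by positivity))

/-! ## §2. (2.26) assembled: Cauchy prefactors × the sup bound -/

variable [DecidableEq ι] [DecidableEq κ]

/-- **(2.26), assembled end to end for the typed term (2.14)** (*"This ends the estimate of the expression (2.14).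
Gathering together all the bounds we get"* (2.26)): under the hypotheses of `norm_core214_F214_le_K` at the σ-radius
`e^{κ₁}` (`κ₁ ≥ 1`) and τ-radii `R_τ(Y) ≥ 2`, and with `∫dμ₀(X)|_Z(lines 2–4)` separately holomorphic in the `σ(Δ)` on an
open `Uσ ⊇ {|σ| ≤ e^{κ₁}}` and in the `τ(Y)` on an open `Uτ ⊇ {|τ| ≤ R_τ(Y)}` (both containing the `r`-discs about
`[0,1]`), base points in the unit polydiscs:
`|(2.14)| ≤ exp(−(κ₁ − 1)|lZ|) · [Π_{Y∈𝐃} 2/R_τ(Y)] · e^{2η|Λ|} · exp(−½γ₂(ε₁²/g_k²)|P| + w) · e^{α₅c|Λ|} · e^{α₅(1+2cg)|N|}`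
— the four factors of (2.26): Cauchy decay in `σ` (`|lZ|` = (LM)⁻⁴|Z∖Z′₀|), the bracket `Π 2/|τ(Y)|`, the large-field
factor, and `exp O(1)α₅|Z|`. [cite: Balaban1988RG2Cluster, (2.14)–(2.15) p.15, (2.16)–(2.22) p.16, (2.23)–(2.26) p.17] -/
theorem norm_term214_le_226_assembled {κ₁ : ℝ} (hκ₁ : 1 ≤ κ₁) (Rτ : κ → ℝ) (hRτ : ∀ Y, 2 ≤ Rτ Y)
    {Uσ Uτ : Set ℂ} (hUσ : IsOpen Uσ) (hUτ : IsOpen Uτ) (hUexp : closedBall (0 : ℂ) (Real.exp κ₁) ⊆ Uσ)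
    (hUtau : ∀ Y, closedBall (0 : ℂ) (Rτ Y) ⊆ Uτ) {r : ℝ} (hr : 0 < r) (hr' : r ≤ Real.exp κ₁ - 1)
    (hsubτ : ∀ s ∈ Set.uIcc (0 : ℝ) 1, closedBall (s : ℂ) r ⊆ Uτ)
    (A : (ι → ℂ) → Matrix Λ Λ ℂ) (Γ : (ι → ℂ) → (Λ ⊕ C₀ → ℝ) → (Λ → ℂ))
    (cardP : ℕ) (χY₀ χcP : (Λ → ℝ) → ℝ) (hχ0 : ∀ B, 0 ≤ χY₀ B) (hχc0 : ∀ B, 0 ≤ χcP B) (Dfam : Finset κ)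
    (V : κ → (Λ → ℝ) → ℂ)
    (hΨσ : ∀ τ : κ → ℂ, (∀ j, τ j ∈ Uτ) → SepHolOn Uσ (fun σ => core214 A Γ (F214 cardP χY₀ χcP Dfam V) σ τ))
    (hΨτ : ∀ σ : ι → ℂ, (∀ j, σ j ∈ Uσ) → SepHolOn Uτ (fun τ => core214 A Γ (F214 cardP χY₀ χcP Dfam V) σ τ))
    {C : Matrix Λ Λ ℝ} (hC : C.PosDef) (Γ₀ : Matrix Λ (Λ ⊕ C₀) ℝ)
    (hAs : ∀ σ : ι → ℂ, (∀ j, ‖σ j‖ ≤ Real.exp κ₁) → (A σ).IsSymm)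
    (hA : ∀ σ : ι → ℂ, (∀ j, ‖σ j‖ ≤ Real.exp κ₁) → ((A σ).map Complex.re).PosDef)
    (hΓc : ∀ σ : ι → ℂ, (∀ j, ‖σ j‖ ≤ Real.exp κ₁) → Continuous (Γ σ))
    {γ₂ rP a w : ℝ} (qP : (Λ → ℝ) → ℝ)
    (h222 : ∀ B, χY₀ B * χcP B ≤ Real.exp (-(γ₂ / 2 * rP ^ 2 * cardP) + γ₂ / 2 * qP B)) (hγ₂ : 0 ≤ γ₂)
    (hqP : ∀ B, qP B ≤ B ⬝ᵥ B) (h220R : ∀ B, ∑ Y ∈ Dfam, Rτ Y * ‖V Y B‖ ≤ a / 2 * (B ⬝ᵥ B) + w)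
    {ρ η c g : ℝ} (hρ0 : 0 ≤ ρ) (ha0 : 0 ≤ a)
    (hR1 : ∀ σ : ι → ℂ, (∀ j, ‖σ j‖ ≤ Real.exp κ₁) → ∀ X : Λ ⊕ C₀ → ℝ,
      -(1 / 2) * ((Γ σ X) ⬝ᵥ ((A σ)⁻¹ *ᵥ Γ σ X)).re ≤ -(1 / 2 * ((Γ₀ *ᵥ X) ⬝ᵥ (C *ᵥ (Γ₀ *ᵥ X)))) + ρ / 2 * (X ⬝ᵥ X))
    (h17a : ∀ σ : ι → ℂ, (∀ j, ‖σ j‖ ≤ Real.exp κ₁) →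
      Real.sqrt (‖(A σ).det‖ / ((A σ).map Complex.re).det) ≤ Real.exp (η * Fintype.card Λ))
    (h17b : ∀ σ : ι → ℂ, (∀ j, ‖σ j‖ ≤ Real.exp κ₁) →
      Real.sqrt (((A σ).map Complex.re).det / C⁻¹.det) ≤ Real.exp (η * Fintype.card Λ))
    (hR2 : ∀ σ : ι → ℂ, (∀ j, ‖σ j‖ ≤ Real.exp κ₁) →
      ∀ B : Λ → ℝ, B ⬝ᵥ ((C⁻¹ - (A σ).map Complex.re) *ᵥ B) ≤ ρ * (B ⬝ᵥ B))
    (hR3 : ∀ σ : ι → ℂ, (∀ j, ‖σ j‖ ≤ Real.exp κ₁) → ∀ (X : Λ ⊕ C₀ → ℝ) (B : Λ → ℝ),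
      -(B ⬝ᵥ fun i => (Γ σ X i).re) ≤ -(B ⬝ᵥ (Γ₀ *ᵥ X)) + ρ / 2 * (X ⬝ᵥ X + B ⬝ᵥ B))
    (hc0 : 0 ≤ c) (hc : ∀ k, hC.1.eigenvalues k ≤ c) (hαc : (2 * ρ + (γ₂ + a)) * c ≤ 1 / 2) (hg : 0 ≤ g)
    (hΓ : ∀ X : Λ ⊕ C₀ → ℝ, (Γ₀ *ᵥ X) ⬝ᵥ (C *ᵥ (Γ₀ *ᵥ X)) ≤ g * (X ⬝ᵥ X))
    (hsmall : (2 * ρ + (γ₂ + a)) * (1 + 2 * c * g) ≤ 1 / 2)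
    {lZ : List ι} (hlZ : lZ.Nodup) {lD : List κ} (hlD : lD.Nodup)
    {σ₀ : ι → ℂ} (hσ₀ : ∀ j, ‖σ₀ j‖ ≤ 1) {τ₀ : κ → ℂ} (hτ₀ : ∀ Y, ‖τ₀ Y‖ ≤ 1) :
    ‖term214 r lZ lD (core214 A Γ (F214 cardP χY₀ χcP Dfam V)) σ₀ τ₀‖ ≤
      Real.exp (-(κ₁ - 1) * lZ.length) * (∏ Y ∈ lD.toFinset, 2 * (Rτ Y)⁻¹)
        * (Real.exp (2 * η * Fintype.card Λ) * Real.exp (-(γ₂ / 2 * rP ^ 2 * cardP) + w)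
          * (Real.exp ((2 * ρ + (γ₂ + a)) * c * Fintype.card Λ)
            * Real.exp ((2 * ρ + (γ₂ + a)) * (1 + 2 * c * g) * Fintype.card (Λ ⊕ C₀)))) :=
  norm_term214_le_215 hκ₁ Rτ hRτ hUσ hUτ hUexp hUtau hr hr' hsubτ hΨσ hΨτ
    (norm_core214_F214_le_K A Γ hC Γ₀ (fun _ => Real.exp κ₁) Rτ hAs hA hΓc cardP χY₀ χcP hχ0 hχc0 Dfam V qP
      h222 hγ₂ hqP h220R hρ0 ha0 hR1 h17a h17b hR2 hR3 hc0 hc hαc hg hΓ hsmall)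
    hlZ hlD hσ₀ hτ₀

/-! ## §3. The same at the τ-radii (2.18): the printed bracket of (2.26) -/

/-- **(2.26) with the printed bracket** `Π_{Y∈𝐃} 2E₀ε₁C₁α₄⁻¹M^q exp C₂κ₁ exp(−(1−3δ)κd_k(Y))` = `Π 2·invTau c (d_k Y)`:
the assembled bound at the τ-radii `|τ(Y)| = (invTau c (d_k Y))⁻¹` of (2.18) (`0 < invTau ≤ ½`, i.e. `|τ(Y)| ≥ 2`),
σ-radius `e^{κ₁}` with the cell's constants record `c : B13.Consts` (`κ₁ = c.κ₁ ≥ 1`); (2.20) is then printed exactly with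
these `|τ(Y)|`. [cite: Balaban1988RG2Cluster, (2.18) p.16, (2.20) p.16, (2.26) p.17] -/
theorem norm_term214_le_226_assembled_218 (cst : B13.Consts) (hκ₁ : 1 ≤ cst.κ₁) (dk : κ → ℝ)
    (hpos : ∀ Y, 0 < invTau cst (dk Y)) (h2 : ∀ Y, invTau cst (dk Y) ≤ 1 / 2)
    {Uσ Uτ : Set ℂ} (hUσ : IsOpen Uσ) (hUτ : IsOpen Uτ) (hUexp : closedBall (0 : ℂ) (Real.exp cst.κ₁) ⊆ Uσ)
    (hUtau : ∀ Y, closedBall (0 : ℂ) ((invTau cst (dk Y))⁻¹) ⊆ Uτ) {r : ℝ} (hr : 0 < r)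
    (hr' : r ≤ Real.exp cst.κ₁ - 1) (hsubτ : ∀ s ∈ Set.uIcc (0 : ℝ) 1, closedBall (s : ℂ) r ⊆ Uτ)
    (A : (ι → ℂ) → Matrix Λ Λ ℂ) (Γ : (ι → ℂ) → (Λ ⊕ C₀ → ℝ) → (Λ → ℂ))
    (cardP : ℕ) (χY₀ χcP : (Λ → ℝ) → ℝ) (hχ0 : ∀ B, 0 ≤ χY₀ B) (hχc0 : ∀ B, 0 ≤ χcP B) (Dfam : Finset κ)
    (V : κ → (Λ → ℝ) → ℂ)
    (hΨσ : ∀ τ : κ → ℂ, (∀ j, τ j ∈ Uτ) → SepHolOn Uσ (fun σ => core214 A Γ (F214 cardP χY₀ χcP Dfam V) σ τ))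
    (hΨτ : ∀ σ : ι → ℂ, (∀ j, σ j ∈ Uσ) → SepHolOn Uτ (fun τ => core214 A Γ (F214 cardP χY₀ χcP Dfam V) σ τ))
    {C : Matrix Λ Λ ℝ} (hC : C.PosDef) (Γ₀ : Matrix Λ (Λ ⊕ C₀) ℝ)
    (hAs : ∀ σ : ι → ℂ, (∀ j, ‖σ j‖ ≤ Real.exp cst.κ₁) → (A σ).IsSymm)
    (hA : ∀ σ : ι → ℂ, (∀ j, ‖σ j‖ ≤ Real.exp cst.κ₁) → ((A σ).map Complex.re).PosDef)
    (hΓc : ∀ σ : ι → ℂ, (∀ j, ‖σ j‖ ≤ Real.exp cst.κ₁) → Continuous (Γ σ))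
    {γ₂ rP a w : ℝ} (qP : (Λ → ℝ) → ℝ)
    (h222 : ∀ B, χY₀ B * χcP B ≤ Real.exp (-(γ₂ / 2 * rP ^ 2 * cardP) + γ₂ / 2 * qP B)) (hγ₂ : 0 ≤ γ₂)
    (hqP : ∀ B, qP B ≤ B ⬝ᵥ B)
    (h220R : ∀ B, ∑ Y ∈ Dfam, (invTau cst (dk Y))⁻¹ * ‖V Y B‖ ≤ a / 2 * (B ⬝ᵥ B) + w)
    {ρ η c g : ℝ} (hρ0 : 0 ≤ ρ) (ha0 : 0 ≤ a)
    (hR1 : ∀ σ : ι → ℂ, (∀ j, ‖σ j‖ ≤ Real.exp cst.κ₁) → ∀ X : Λ ⊕ C₀ → ℝ,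
      -(1 / 2) * ((Γ σ X) ⬝ᵥ ((A σ)⁻¹ *ᵥ Γ σ X)).re ≤ -(1 / 2 * ((Γ₀ *ᵥ X) ⬝ᵥ (C *ᵥ (Γ₀ *ᵥ X)))) + ρ / 2 * (X ⬝ᵥ X))
    (h17a : ∀ σ : ι → ℂ, (∀ j, ‖σ j‖ ≤ Real.exp cst.κ₁) →
      Real.sqrt (‖(A σ).det‖ / ((A σ).map Complex.re).det) ≤ Real.exp (η * Fintype.card Λ))
    (h17b : ∀ σ : ι → ℂ, (∀ j, ‖σ j‖ ≤ Real.exp cst.κ₁) →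
      Real.sqrt (((A σ).map Complex.re).det / C⁻¹.det) ≤ Real.exp (η * Fintype.card Λ))
    (hR2 : ∀ σ : ι → ℂ, (∀ j, ‖σ j‖ ≤ Real.exp cst.κ₁) →
      ∀ B : Λ → ℝ, B ⬝ᵥ ((C⁻¹ - (A σ).map Complex.re) *ᵥ B) ≤ ρ * (B ⬝ᵥ B))
    (hR3 : ∀ σ : ι → ℂ, (∀ j, ‖σ j‖ ≤ Real.exp cst.κ₁) → ∀ (X : Λ ⊕ C₀ → ℝ) (B : Λ → ℝ),
      -(B ⬝ᵥ fun i => (Γ σ X i).re) ≤ -(B ⬝ᵥ (Γ₀ *ᵥ X)) + ρ / 2 * (X ⬝ᵥ X + B ⬝ᵥ B))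
    (hc0 : 0 ≤ c) (hc : ∀ k, hC.1.eigenvalues k ≤ c) (hαc : (2 * ρ + (γ₂ + a)) * c ≤ 1 / 2) (hg : 0 ≤ g)
    (hΓ : ∀ X : Λ ⊕ C₀ → ℝ, (Γ₀ *ᵥ X) ⬝ᵥ (C *ᵥ (Γ₀ *ᵥ X)) ≤ g * (X ⬝ᵥ X))
    (hsmall : (2 * ρ + (γ₂ + a)) * (1 + 2 * c * g) ≤ 1 / 2)
    {lZ : List ι} (hlZ : lZ.Nodup) {lD : List κ} (hlD : lD.Nodup)
    {σ₀ : ι → ℂ} (hσ₀ : ∀ j, ‖σ₀ j‖ ≤ 1) {τ₀ : κ → ℂ} (hτ₀ : ∀ Y, ‖τ₀ Y‖ ≤ 1) :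
    ‖term214 r lZ lD (core214 A Γ (F214 cardP χY₀ χcP Dfam V)) σ₀ τ₀‖ ≤
      Real.exp (-(cst.κ₁ - 1) * lZ.length) * (∏ Y ∈ lD.toFinset, 2 * invTau cst (dk Y))
        * (Real.exp (2 * η * Fintype.card Λ) * Real.exp (-(γ₂ / 2 * rP ^ 2 * cardP) + w)
          * (Real.exp ((2 * ρ + (γ₂ + a)) * c * Fintype.card Λ)
            * Real.exp ((2 * ρ + (γ₂ + a)) * (1 + 2 * c * g) * Fintype.card (Λ ⊕ C₀)))) :=
  norm_term214_le_226 cst hκ₁ dk hUσ hUτ hUexp hUtau hr hr' hsubτ hΨσ hΨτ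
    (norm_core214_F214_le_K A Γ hC Γ₀ (fun _ => Real.exp cst.κ₁) (fun Y => (invTau cst (dk Y))⁻¹) hAs hA hΓc
      cardP χY₀ χcP hχ0 hχc0 Dfam V qP h222 hγ₂ hqP h220R hρ0 ha0 hR1 h17a h17b hR2 hR3 hc0 hc hαc hg hΓ hsmall)
    hlZ hlD hpos h2 hσ₀ hτ₀

/-! ## §4 (v1.1, append-only). The window-model shape of the sup bound: `K ≤ e^{−½γ₂(ε₁²/g_k²)|P|}·e^{a₅·#cells(Z)}` -/

/-- **The constant `K` in the shape consumed by the resummation** (`B13Lemma3WindowCauchy.h226_of_cauchy`, hypothesis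
`hK`: `‖Ψ σ τ‖ ≤ exp(−½a|P|)·exp(a₅·#LM-cubes of Z)`): when the real dimensions are proportional to the number `n` of
`LM`-cubes of `Z` — `|Λ| ≤ k_Λ·n` (`Z₀ ⊂ Z`), `|N| ≤ k_N·n`, and `w ≤ k_w·n` (`w = O(1)α₄M⁻⁴|Y₀|`, `Y₀ ⊂ Z`) — the
constant `e^{2η|Λ|}·exp(−½γ₂r²|P| + w)·e^{α₅c|Λ|}·e^{α₅(1+2cg)|N|}` of `norm_core214_F214_le_K` is
`≤ exp(−½γ₂r²|P|)·exp(a₅·n)` with `a₅ = 2ηk_Λ + k_w + α₅ck_Λ + α₅(1+2cg)k_N` — the printed `exp O(1)α₅|Z|`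
(arithmetic). [cite: Balaban1988RG2Cluster, (2.26) p.17] (elementary API for (2.26)) -/
theorem K_le_window_shape {η γ₂ rP w α c g n kΛ kN kw : ℝ} {nΛ nN cardP : ℕ} (hη : 0 ≤ η) (hα : 0 ≤ α)
    (hc : 0 ≤ c) (hg : 0 ≤ g) (hΛ : (nΛ : ℝ) ≤ kΛ * n) (hN : (nN : ℝ) ≤ kN * n) (hw : w ≤ kw * n) :
    Real.exp (2 * η * nΛ) * Real.exp (-(γ₂ / 2 * rP ^ 2 * cardP) + w)
        * (Real.exp (α * c * nΛ) * Real.exp (α * (1 + 2 * c * g) * nN))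
      ≤ Real.exp (-(γ₂ * rP ^ 2 / 2 * cardP)) * Real.exp ((2 * η * kΛ + kw + α * c * kΛ + α * (1 + 2 * c * g) * kN) * n) := by
  simp only [← Real.exp_add]
  refine Real.exp_le_exp.2 ?_
  have h1 : 2 * η * (nΛ : ℝ) ≤ 2 * η * (kΛ * n) := mul_le_mul_of_nonneg_left hΛ (by positivity)
  have h2 : α * c * (nΛ : ℝ) ≤ α * c * (kΛ * n) := mul_le_mul_of_nonneg_left hΛ (by positivity)
  have h3 : α * (1 + 2 * c * g) * (nN : ℝ) ≤ α * (1 + 2 * c * g) * (kN * n) :=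
    mul_le_mul_of_nonneg_left hN (by positivity)
  nlinarith

omit [DecidableEq ι] [DecidableEq κ] in
/-- **`hK` of `B13Lemma3WindowCauchy.h226_of_cauchy` from the typed objects**: under the hypotheses of
`norm_core214_F214_le_K` and the proportionality of the dimensions to the number `n` of `LM`-cubes of `Z`
(`|Λ| ≤ k_Λn`, `|N| ≤ k_Nn`, `w ≤ k_wn`, `η ≥ 0`), on the two closed polydiscs
`‖∫dμ₀(X)|_Z (lines 2–4 of (2.14))(σ, τ)‖ ≤ exp(−½(γ₂r²)|P|) · exp(a₅·n)`, `a₅ = 2ηk_Λ + k_w + α₅ck_Λ + α₅(1+2cg)k_N`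
— the sup bound in the exact shape `exp(−½a|P|)·exp(a₅·#cells Z)` (`a = γ₂r²`, `r = ε₁/g_k`) that the window-model
joiner consumes. [cite: Balaban1988RG2Cluster, (2.15) p.15, (2.26) p.17] -/
theorem norm_core214_F214_le_window_shape (A : (ι → ℂ) → Matrix Λ Λ ℂ) (Γ : (ι → ℂ) → (Λ ⊕ C₀ → ℝ) → (Λ → ℂ))
    {C : Matrix Λ Λ ℝ} (hC : C.PosDef) (Γ₀ : Matrix Λ (Λ ⊕ C₀) ℝ) (Rσ : ι → ℝ) (Rτ : κ → ℝ)
    (hAs : ∀ σ : ι → ℂ, (∀ j, ‖σ j‖ ≤ Rσ j) → (A σ).IsSymm)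
    (hA : ∀ σ : ι → ℂ, (∀ j, ‖σ j‖ ≤ Rσ j) → ((A σ).map Complex.re).PosDef)
    (hΓc : ∀ σ : ι → ℂ, (∀ j, ‖σ j‖ ≤ Rσ j) → Continuous (Γ σ))
    (cardP : ℕ) (χY₀ χcP : (Λ → ℝ) → ℝ) (hχ0 : ∀ B, 0 ≤ χY₀ B) (hχc0 : ∀ B, 0 ≤ χcP B) (Dfam : Finset κ)
    (V : κ → (Λ → ℝ) → ℂ) {γ₂ rP a w : ℝ} (qP : (Λ → ℝ) → ℝ)
    (h222 : ∀ B, χY₀ B * χcP B ≤ Real.exp (-(γ₂ / 2 * rP ^ 2 * cardP) + γ₂ / 2 * qP B)) (hγ₂ : 0 ≤ γ₂)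
    (hqP : ∀ B, qP B ≤ B ⬝ᵥ B) (h220R : ∀ B, ∑ Y ∈ Dfam, Rτ Y * ‖V Y B‖ ≤ a / 2 * (B ⬝ᵥ B) + w)
    {ρ η c g : ℝ} (hρ0 : 0 ≤ ρ) (ha0 : 0 ≤ a) (hη0 : 0 ≤ η)
    (hR1 : ∀ σ : ι → ℂ, (∀ j, ‖σ j‖ ≤ Rσ j) → ∀ X : Λ ⊕ C₀ → ℝ, -(1 / 2) * ((Γ σ X) ⬝ᵥ ((A σ)⁻¹ *ᵥ Γ σ X)).re
      ≤ -(1 / 2 * ((Γ₀ *ᵥ X) ⬝ᵥ (C *ᵥ (Γ₀ *ᵥ X)))) + ρ / 2 * (X ⬝ᵥ X))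
    (h17a : ∀ σ : ι → ℂ, (∀ j, ‖σ j‖ ≤ Rσ j) →
      Real.sqrt (‖(A σ).det‖ / ((A σ).map Complex.re).det) ≤ Real.exp (η * Fintype.card Λ))
    (h17b : ∀ σ : ι → ℂ, (∀ j, ‖σ j‖ ≤ Rσ j) →
      Real.sqrt (((A σ).map Complex.re).det / C⁻¹.det) ≤ Real.exp (η * Fintype.card Λ))
    (hR2 : ∀ σ : ι → ℂ, (∀ j, ‖σ j‖ ≤ Rσ j) →
      ∀ B : Λ → ℝ, B ⬝ᵥ ((C⁻¹ - (A σ).map Complex.re) *ᵥ B) ≤ ρ * (B ⬝ᵥ B))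
    (hR3 : ∀ σ : ι → ℂ, (∀ j, ‖σ j‖ ≤ Rσ j) → ∀ (X : Λ ⊕ C₀ → ℝ) (B : Λ → ℝ),
      -(B ⬝ᵥ fun i => (Γ σ X i).re) ≤ -(B ⬝ᵥ (Γ₀ *ᵥ X)) + ρ / 2 * (X ⬝ᵥ X + B ⬝ᵥ B))
    (hc0 : 0 ≤ c) (hc : ∀ k, hC.1.eigenvalues k ≤ c) (hαc : (2 * ρ + (γ₂ + a)) * c ≤ 1 / 2) (hg : 0 ≤ g)
    (hΓ : ∀ X : Λ ⊕ C₀ → ℝ, (Γ₀ *ᵥ X) ⬝ᵥ (C *ᵥ (Γ₀ *ᵥ X)) ≤ g * (X ⬝ᵥ X))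
    (hsmall : (2 * ρ + (γ₂ + a)) * (1 + 2 * c * g) ≤ 1 / 2)
    {n kΛ kN kw : ℝ} (hΛ : (Fintype.card Λ : ℝ) ≤ kΛ * n) (hN : (Fintype.card (Λ ⊕ C₀) : ℝ) ≤ kN * n)
    (hw : w ≤ kw * n) :
    ∀ (σ : ι → ℂ) (τ : κ → ℂ), (∀ j, ‖σ j‖ ≤ Rσ j) → (∀ Y, ‖τ Y‖ ≤ Rτ Y) →
      ‖core214 A Γ (F214 cardP χY₀ χcP Dfam V) σ τ‖
        ≤ Real.exp (-(γ₂ * rP ^ 2 / 2 * cardP))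
          * Real.exp ((2 * η * kΛ + kw + (2 * ρ + (γ₂ + a)) * c * kΛ
              + (2 * ρ + (γ₂ + a)) * (1 + 2 * c * g) * kN) * n) :=
  fun σ τ hσ hτ =>
    (norm_core214_F214_le_K A Γ hC Γ₀ Rσ Rτ hAs hA hΓc cardP χY₀ χcP hχ0 hχc0 Dfam V qP h222 hγ₂ hqP h220R hρ0 ha0
      hR1 h17a h17b hR2 hR3 hc0 hc hαc hg hΓ hsmall σ τ hσ hτ).trans
    (K_le_window_shape hη0 (by linarith) hc0 hg hΛ hN hw)

end Literature.MathematicalPhysics.QuantumFieldTheory.Balaban1983to89.B13Bound226Assembly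

end
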